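import Summits.BirchSwinnertonDyer.BirchSwinnertonDyer.Theses.AdditiveKolyvaginRoad
import Summits.BirchSwinnertonDyer.BirchSwinnertonDyer.Theorems.AdditiveKolyvaginRoadManinFrameTransport
import Summits.BirchSwinnertonDyer.BirchSwinnertonDyer.Theorems.AdditiveKolyvaginRoadManinFrameFromDatum
import Summits.BirchSwinnertonDyer.BirchSwinnertonDyer.Theorems.AdditiveKolyvaginRoadManinFrameResidueProperTwistDegree
import Literature.NumberTheory.EllipticCurves.IsogenyPotentiallyGoodMinimalDiscriminant
import HarnessLib

/-! # Birth skeleton (BC3) v1 for crux `ManinFrameResidueProperR` (stmt-BirchSwinnertonDyer-20709, route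
AdditiveKolyvaginRoad rev 13; = item 20483 `ManinFrameResidueProper` GRANTED the route's published inputs
`EdixhovenManinNonPotOrdinary`, `EdixhovenManinKodairaType` and `DokchitserIsogenyMinimalDiscriminant`
(stmt-20708, Dokchitser–Dokchitser 2015 Thm 5.1 (1)) — T10 plumbing, director W-19 GO-R)
— tenure desk bsd-wall-add g6, 2026-08-27.

LINE `birth` = v3 of `Cruxes/ManinFrameResidueProper/Lines/birth.lean` (g4) with the `p ≥ 11` stub
RESHAPED along manin-p1's landed translation p540328
(`…ManinFrameResidueProperTwistDegree.stub_memberManinUnit_ordinary_of_twistDegreeStep`):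
* S57 `stub_memberManinUnit_fiveSeven` — VERBATIM v3 (Edixhoven's facts say nothing at p ∈ {5,7});
* TDS `stub_twistDegreeStep` — MANIN-FREE: on the p ≥ 11 residue (binders of v3's S11 verbatim), for
  every unstarred (G)-ordinary minimal member V ∼ W (type II/III/IV, ord_p Δ_min ≤ 4) and every minimal
  model W♭ of V ⊗ χ_{p*}, SOME conductor-level datum of V has fewer factors p in its degree than EVERY
  conductor-level datum of W♭ (Edixhoven 1991 §4 "case 2"); research, not in print;
* composition `ManinFrameResidueProperR_of : S57 → TDS → ManinFrameResidueProperR`, a real proof: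
  p < 11 → S57; p ≥ 11 → `stub_memberManinUnit_ordinary_of_twistDegreeStep e1 e2 dd hnf …` (p540328,
  uses all three granted facts), then prime-to-p transport (`ManinFrameTransport…`) and the
  Hoffstein–Luo frame (`ManinFrameFromDatum…`) exactly as v3.
Why the facts must be crux binders: TDS ⟹ (member with p ∤ c) needs Edixhoven Thm 3 on the STARRED twist
class and DD2015 for the transport of `4 < ord_p Δ_min`; item 20483 carries only
`PublishedInputsAdditiveKoly`, so no skeleton over 20483 can expose TDS (a stub equal to a named fact
never closes). Honours: no Disproof.lean for this crux (none exists). -/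

set_option autoImplicit false
set_option linter.dupNamespace false

noncomputable section

open scoped Classical


open WeierstrassCurve NumberField Literature.NumberTheory.EllipticCurves
  Literature.NumberTheory.EllipticCurves.ModularForms
  Literature.NumberTheory.EllipticCurves.Rank1Residual
  Literature.NumberTheory.DiophantineGeometry IsDedekindDomain Rat.HeightOneSpectrum
  Summit.BirchSwinnertonDyer.Rank1Residual Summit.BirchSwinnertonDyer.Rank1Residual.Additive
  Summit.BirchSwinnertonDyer.BirchSwinnertonDyer.Theses.AdditiveKolyvaginRoad

namespace Summit.BirchSwinnertonDyer.BirchSwinnertonDyer.Cruxes.ManinFrameResidueProperR.Birth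

/-- **Stub S57 — Manin's `p`-part for SOME minimal member, `p ∈ {5, 7}`** (research; VERBATIM the
registered S57 of `Cruxes/ManinFrameResidueProper/Lines/birth.lean` v3): on the residue at `p = 5, 7`
(additive, `E[p]` irreducible, no `Iₙ*` member, every parametrisation of every minimal member at
level `N(W)` of degree divisible by `p`), some globally minimal `W₀ ∼ W` has a parametrisation
datum at level `N(W)` with `p ∤ c(D₀)`. [cite: EdixhovenManin1991, Thm. 3 and Prop. 7]
[cite: AgasheRibetStein2006, Thm. 2.6] [cite: CesnaviciusNeururerSaha2023, Thm. 1.2] -/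
theorem stub_memberManinUnit_fiveSeven
    (hnf : Literature.NumberTheory.EllipticCurves.ModularForms.exists_isNewformOf)
    (W : WeierstrassCurve ℚ) [W.IsElliptic] [W.IsGloballyMinimal] (p : ℕ) [Fact p.Prime]
    [NeZero (W.conductorNorm ℤ)] (hp5 : 5 ≤ p) (hp11 : p < 11) (hadd : Addv W p) (hirr : Irr W p)
    (hres : ((p < 11 ∨ ∃ (W' : WeierstrassCurve ℚ) (_ : W'.IsElliptic) (_ : W'.IsGloballyMinimal),
          IsIsogenous W W' ∧ TypeGOrd W' p ∧ padicValInt p W'.minimalDiscriminantInt ≤ 4) ∧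
        (∃ (W' : WeierstrassCurve ℚ) (_ : W'.IsElliptic) (_ : W'.IsGloballyMinimal),
          IsIsogenous W W' ∧ ∀ (v : HeightOneSpectrum ℤ) (n : ℕ), natGenerator v = p →
            W'.kodairaSymbolAt v ≠ KodairaSymbol.Istar n)))
    (hall : (∀ (W' : WeierstrassCurve ℚ) [W'.IsElliptic] [W'.IsGloballyMinimal]
          (D' : ModularParametrizationData W' (W.conductorNorm ℤ)),
          IsIsogenous W W' → p ∣ D'.modularDegree)) :
    ∃ (W₀ : WeierstrassCurve ℚ) (_ : W₀.IsElliptic) (_ : W₀.IsGloballyMinimal)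
        (D₀ : ModularParametrizationData W₀ (W.conductorNorm ℤ)),
        IsIsogenous W W₀ ∧ ¬ (p : ℤ) ∣ D₀.c := by
  sorry

/-- **Stub TDS — the twist-degree step on the `p ≥ 11` residue** (research, MANIN-FREE; Edixhoven
1991 §4 "case 2"): for a residue frame `(W, p)` (binders of the registered S11 verbatim: `p ≥ 11`,
additive, `E[p]` irreducible, residue clause, all degrees at level `N(W)` divisible by `p`), every
unstarred (G)-ordinary globally minimal member `V ∼ W` (Kodaira II/III/IV at `p`, `ord_p Δ_min ≤ 4`)
and every globally minimal model `W♭` of `V ⊗ χ_{p*}`: SOME conductor-level parametrisation datum of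
`V` has STRICTLY FEWER factors `p` in its modular degree than EVERY conductor-level datum of `W♭`
(print gives `v_p(deg φ̃) = v_p(deg φ) + 1 + 2 v_p(c̃/c)` with `p ∤ c̃`; the stub says the `+1`
branch, i.e. Edixhoven's case 1 never occurs). Equivalent to S11 granted the facts
(`exists_member_not_dvd_c_iff_twistDegreeStep`, p540328); lattice form p542525; instance-true on
85 108/85 108 (G)-ord optimal pairs of conductor < 5·10⁵ (cell b2b-bsdres census gen16).
[cite: EdixhovenManin1991, §4 (cases 1/2)] [cite: ZagierCMB1985, §1]
[cite: AgasheRibetStein2012, Conj. 2.2] -/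
theorem stub_twistDegreeStep
    (hnf : Literature.NumberTheory.EllipticCurves.ModularForms.exists_isNewformOf)
    (W : WeierstrassCurve ℚ) [W.IsElliptic] [W.IsGloballyMinimal] (p : ℕ) [Fact p.Prime]
    [NeZero (W.conductorNorm ℤ)] (hp11 : 11 ≤ p) (hadd : Addv W p) (hirr : Irr W p)
    (hres : ((p < 11 ∨ ∃ (W' : WeierstrassCurve ℚ) (_ : W'.IsElliptic) (_ : W'.IsGloballyMinimal),
          IsIsogenous W W' ∧ TypeGOrd W' p ∧ padicValInt p W'.minimalDiscriminantInt ≤ 4) ∧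
        (∃ (W' : WeierstrassCurve ℚ) (_ : W'.IsElliptic) (_ : W'.IsGloballyMinimal),
          IsIsogenous W W' ∧ ∀ (v : HeightOneSpectrum ℤ) (n : ℕ), natGenerator v = p →
            W'.kodairaSymbolAt v ≠ KodairaSymbol.Istar n)))
    (hall : (∀ (W' : WeierstrassCurve ℚ) [W'.IsElliptic] [W'.IsGloballyMinimal]
          (D' : ModularParametrizationData W' (W.conductorNorm ℤ)),
          IsIsogenous W W' → p ∣ D'.modularDegree))
    (V : WeierstrassCurve ℚ) [V.IsElliptic] [V.IsGloballyMinimal] [NeZero (V.conductorNorm ℤ)]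
    (Wf : WeierstrassCurve ℚ) [Wf.IsElliptic] [Wf.IsGloballyMinimal] [NeZero (Wf.conductorNorm ℤ)]
    (C : VariableChange ℚ) (hisoV : IsIsogenous W V) (hG : TypeGOrd V p)
    (hV4 : padicValInt p V.minimalDiscriminantInt ≤ 4)
    (hC : C • V.quadraticTwist ((-1 : ℚ) ^ (p / 2) * p) = Wf) :
    ∃ D : ModularParametrizationData V (V.conductorNorm ℤ),
      ∀ Df : ModularParametrizationData Wf (Wf.conductorNorm ℤ),
        padicValNat p D.modularDegree < padicValNat p Df.modularDegree := by
  sorry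

/-- **The composition (no sorry of its own; the two stubs are used BY NAME inside the proof, the
registered-skeleton convention of `Cruxes/ManinFrameResidueProper/Lines/birth.lean` v3) ⟹ `ManinFrameResidueProperR`.**
`p < 11`: S57. `p ≥ 11`: manin-p1's landed `stub_memberManinUnit_ordinary_of_twistDegreeStep`
(p540328) fed with the three granted facts and TDS. Then, as in v3: transport to a datum of `W` with
`p ∤ c` (`ManinFrameTransport.exists_modularParametrizationData_not_dvd_of_partner`, Irr) and the
Hoffstein–Luo odd Heegner frame (`ManinFrameFromDatum.exists_oddHeegnerFrame_of_exists_not_dvd`,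
conjuncts 6 and 7 of `PublishedInputsAdditiveKoly`). -/
theorem ManinFrameResidueProperR_of :
    Summit.BirchSwinnertonDyer.BirchSwinnertonDyer.Theses.AdditiveKolyvaginRoad.ManinFrameResidueProperR := by
  intro e1 e2 dd hPub W _ _ p hp _ hp5 hadd hirr hres hall hr
  have hnf : Literature.NumberTheory.EllipticCurves.ModularForms.exists_isNewformOf := hPub.2.2.2.2.2.1
  -- a member with a Manin-unit datum, by prime range (S57 / TDS through p540328)
  have hmem : ∃ (W₀ : WeierstrassCurve ℚ) (_ : W₀.IsElliptic) (_ : W₀.IsGloballyMinimal)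
      (D₀ : ModularParametrizationData W₀ (W.conductorNorm ℤ)),
      IsIsogenous W W₀ ∧ ¬ (p : ℤ) ∣ D₀.c := by
    rcases lt_or_ge p 11 with h11 | h11
    · exact stub_memberManinUnit_fiveSeven hnf W p hp5 h11 hadd hirr hres hall
    · exact Summit.BirchSwinnertonDyer.BirchSwinnertonDyer.Theorems.ManinFrameResidueProperTwistDegree.stub_memberManinUnit_ordinary_of_twistDegreeStep
        e1 e2 dd hnf W p h11 hadd hirr hres
        (fun V _ _ _ Wf _ _ _ C hiso hG hV4 hC =>
          stub_twistDegreeStep hnf W p h11 hadd hirr hres hall V Wf C hiso hG hV4 hC)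
  obtain ⟨W₀, hE₀, hM₀, D₀, hiso, hc₀⟩ := hmem
  haveI := hE₀
  haveI := hM₀
  -- transport to a datum of `W` with `p ∤ c` (prime-to-`p` isogeny multiplier under Irr)
  obtain ⟨Dt, hc⟩ :=
    Summit.BirchSwinnertonDyer.BirchSwinnertonDyer.Theorems.ManinFrameTransport.exists_modularParametrizationData_not_dvd_of_partner
      W hp.out hirr hiso D₀ hc₀
  -- the Hoffstein–Luo odd Heegner frame
  have hp2 : p ≠ 2 := by omega
  exact Summit.BirchSwinnertonDyer.BirchSwinnertonDyer.Theorems.ManinFrameFromDatum.exists_oddHeegnerFrame_of_exists_not_dvd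
    hnf hPub.2.2.2.2.2.2.1 W p hr hp2 ⟨Dt, hc⟩

end Summit.BirchSwinnertonDyer.BirchSwinnertonDyer.Cruxes.ManinFrameResidueProperR.Birth

end
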